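import Mathlib.AlgebraicGeometry.Morphisms.Separated
import Mathlib.RingTheory.DedekindDomain.Factorization
import Literature.AnabelianGeometry.AbsoluteAnabelian.AbsTopIII.KummerFaithful
import HarnessLib

/-!
# [AbsTopIII] Rmk. 1.5.4 (i), "restricting to closed points": sections agreeing at infinitely many closed points

Proof-only companion (no new definitions) to `AbsTopIII/KummerFaithful.lean` (S. Mochizuki, *Topics in
Absolute Anabelian Geometry III*, §1, Rmk. 1.5.4 (i) p. 33, lit key `paper:url-5493eb38cbb7`: "by
restricting to various closed points of this variety, one reduces to the case where `k` itself is an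
MLF").  Junction J-d of the route of record for the last open part of FACT-LIST row F-0369
(HOME/staging/f/f-083/g2/F0369-FG-ROUTE.md): once a divisible point `x ∈ A(L)` has been turned into a
global section of a proper smooth group scheme `𝒜 → Spec R` (`R` Dedekind, the curve model of `L`)
whose reductions at infinitely many closed points are trivial, one needs: **two sections of a separated
`Spec R`-scheme that agree at infinitely many points of `Spec R` are equal.**  This is Mathlib's
`ext_of_fromSpecResidueField_eq` (reduced source, separated target, agreement on a dense set of
residue-field points) together with the elementary fact, proved here, that an infinite subset of the
spectrum of a Dedekind domain is dense (a closed subset is `V(I)`; for `I ≠ 0` it consists of the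
finitely many prime factors of `I`).

* `PrimeSpectrum.finite_zeroLocus_of_ne_bot` — `V(I)` is finite for `I ≠ 0` in a Dedekind domain;
* `PrimeSpectrum.dense_of_infinite` — an infinite set of points of `Spec R` is dense;
* `Spec.hom_ext_of_infinite_of_isSeparated` — morphisms `Spec R → Y` over a separated `Y → Z` agreeing
  at the residue-field points of an infinite set are equal; `Spec.sections_ext_of_infinite` — the
  case of two sections of a separated `Y → Spec R`.

Mathlib only; nothing here bears on [IUTchIII] Cor. 3.12; typed ≠ discharged.
-/

noncomputable section

open scoped Classical

namespace Literature.AnabelianGeometry.AbsoluteAnabelian.AbsTopIII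

universe u

open _root_.CategoryTheory _root_.AlgebraicGeometry IsDedekindDomain

variable {A : Type u} [CommRing A] [IsDedekindDomain A]

/-- In a Dedekind domain, the set `V(I)` of primes containing a NON-ZERO ideal `I` is finite: such a
prime is non-zero, hence maximal, hence a prime factor of `I` (Mathlib `Ideal.finite_factors`).
[cite: MochizukiAbsTopIII2015, Rmk 1.5.4 (i) p.33] -/
theorem PrimeSpectrum.finite_zeroLocus_of_ne_bot {I : Ideal A} (hI : I ≠ ⊥) :
    (PrimeSpectrum.zeroLocus (I : Set A)).Finite := by
  have hne : ∀ p ∈ PrimeSpectrum.zeroLocus (I : Set A), p.asIdeal ≠ ⊥ := by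
    intro p hp h
    apply hI
    rw [PrimeSpectrum.mem_zeroLocus, SetLike.coe_subset_coe, h, le_bot_iff] at hp
    exact hp
  -- inject `V(I)` into the finite set of prime factors of `I`
  let f : PrimeSpectrum.zeroLocus (I : Set A) → {v : HeightOneSpectrum A | v.asIdeal ∣ I} :=
    fun p => ⟨⟨p.1.asIdeal, p.1.isPrime, hne p.1 p.2⟩, by
      show (⟨p.1.asIdeal, p.1.isPrime, hne p.1 p.2⟩ : HeightOneSpectrum A).asIdeal ∣ I
      have hp := p.2
      rw [PrimeSpectrum.mem_zeroLocus, SetLike.coe_subset_coe] at hp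
      exact Ideal.dvd_iff_le.mpr hp⟩
  have hf : Function.Injective f := by
    rintro ⟨p, hp⟩ ⟨q, hq⟩ h
    have h' := congrArg (fun v : {v : HeightOneSpectrum A | v.asIdeal ∣ I} => v.1.asIdeal) h
    exact Subtype.ext (PrimeSpectrum.ext h')
  haveI : Finite {v : HeightOneSpectrum A | v.asIdeal ∣ I} := (Ideal.finite_factors hI).to_subtype
  exact Set.finite_coe_iff.mp (Finite.of_injective f hf)

/-- **An infinite set of points of the spectrum of a Dedekind domain is dense**: its closure is a
closed set `V(I)` containing infinitely many points, so `I = 0` and `V(I)` is everything ("various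
closed points" are Zariski dense, [AbsTopIII] Rmk. 1.5.4 (i) p. 33).
[cite: MochizukiAbsTopIII2015, Rmk 1.5.4 (i) p.33] -/
theorem PrimeSpectrum.dense_of_infinite {S : Set (PrimeSpectrum A)} (hS : S.Infinite) : Dense S := by
  obtain ⟨I, hI⟩ := (PrimeSpectrum.isClosed_iff_zeroLocus_ideal (closure S)).mp isClosed_closure
  by_cases h : I = ⊥
  · subst h
    rw [dense_iff_closure_eq, hI]
    simp
  · exact absurd ((PrimeSpectrum.finite_zeroLocus_of_ne_bot h).subset (hI ▸ subset_closure)) hS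

/-- **Morphisms out of `Spec` of a Dedekind domain agreeing at infinitely many points are equal**
(over a separated target): for `f g : Spec A → Y` with `f ≫ i = g ≫ i`, `i : Y → Z` separated, if
`f` and `g` agree on the residue-field points of an infinite set of points of `Spec A`, then `f = g` —
Mathlib `ext_of_fromSpecResidueField_eq` (`Spec A` is reduced) with `PrimeSpectrum.dense_of_infinite`.
[cite: MochizukiAbsTopIII2015, Rmk 1.5.4 (i) p.33] -/
theorem Spec.hom_ext_of_infinite_of_isSeparated {Y Z : Scheme.{u}} (f g : Spec (.of A) ⟶ Y)
    (i : Y ⟶ Z) [IsSeparated i] (hfg : f ≫ i = g ≫ i) (S : Set (Spec (.of A))) (hS : S.Infinite)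
    (H : ∀ x ∈ S, (Spec (.of A)).fromSpecResidueField x ≫ f =
      (Spec (.of A)).fromSpecResidueField x ≫ g) : f = g :=
  ext_of_fromSpecResidueField_eq f g i S (PrimeSpectrum.dense_of_infinite hS) H hfg

/-- **Two sections of a separated scheme over `Spec` of a Dedekind domain that agree at infinitely
many (closed) points are equal** — the form used by the closed-point argument of [AbsTopIII]
Rmk. 1.5.4 (i) p. 33 (a section whose reductions at infinitely many closed points are the identity is
the identity section). [cite: MochizukiAbsTopIII2015, Rmk 1.5.4 (i) p.33] -/
theorem Spec.sections_ext_of_infinite {Y : Scheme.{u}} (q : Y ⟶ Spec (.of A)) [IsSeparated q]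
    (s t : Spec (.of A) ⟶ Y) (hs : s ≫ q = 𝟙 _) (ht : t ≫ q = 𝟙 _) (S : Set (Spec (.of A)))
    (hS : S.Infinite)
    (H : ∀ x ∈ S, (Spec (.of A)).fromSpecResidueField x ≫ s =
      (Spec (.of A)).fromSpecResidueField x ≫ t) : s = t :=
  Spec.hom_ext_of_infinite_of_isSeparated s t q (by rw [hs, ht]) S hS H

end Literature.AnabelianGeometry.AbsoluteAnabelian.AbsTopIII
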